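import Summits.Ventures.YMGap.Thresholds.RegionPoincare
import Summits.Ventures.YMGap.Thresholds.SharpClusteringSmooth
import Literature.Probability.LatticeModels.DobrushinMetricStates
import HarnessLib

/-!
# Venture YMGap — OBJECT U, piece U4: DLR ASSEMBLY — vanishing boundary influence of the kernels
# on Lipschitz (or smooth) cylinder functions ⇒ uniqueness of the `SU(N)` lattice Yang–Mills DLR state

HONEST FRAMING: venture file (cell `pub-ymgap`, track (a), OBJECT U of PLAN R132/R132′, seat p1).
Strong-coupling LATTICE bookkeeping; nothing about the continuum. This file is a DOOR: it TYPES the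
hypothesis «the DLR kernels `γ_E(· | η) = ymSpecification (fundamentalRep (Fin N)) β E η` forget their
boundary condition on every Lipschitz cylinder function as `E ↑ ℤ^d`» in two shapes —
`KernelInfluenceVanishes d N β` (Lipschitz cylinders `IsLipschitzCylinder`, the observables of the tree's
`shen_zhu_zhu` / `MassGapAt`) and `SmoothKernelInfluenceVanishes d N β` (smooth functions of the link
matrices with per-link Frobenius–Lipschitz data `LinkLipschitz`, the currency of the cell's Bakry–Émery /
covariance files and of piece U3) — and PROVES that either one implies
`HasUniqueGibbsMeasure (ymSpecification (fundamentalRep (Fin N)) β)` (exactly one DLR state).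
NOTHING is asserted about the hypotheses: U3 (`Thresholds/RegionBoundaryTilt.lean`, seat p2; exponential
tilt + the kernel covariance decay U2 of lit-1 with ds-2's off-diagonal Hessian brick U1) supplies the
smooth shape at every 't Hooft coupling `|β'| < 1/(8d)` (`β = N β'`); the JOIN file
`Thresholds/SharpUniquenessJoin.lean` composes.

Proof (Georgii 2011, Remark 1.24 / Friedli–Velenik 2017, Lemma 6.22 «since this holds for all local
functions, μ = ν»): for DLR states `μ, ν` and an observable `F`, `μ(F) = ∫ γ_E(F | ·) dμ` and
`ν(F) = ∫ γ_E(F | ·) dν` (DLR in integral form, tree `IsGibbsMeasure.integral_integral_eq`), so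
`|μ(F) − ν(F)| ≤ sup_{η,η'} |γ_E(F|η) − γ_E(F|η')| ≤ ε` for every `ε`; hence `μ` and `ν` agree on every
Lipschitz cylinder function. The tree's closing step `DobrushinMetric.measure_eq_of_forall_integral_eq_of_isLipBound`
(closed boxes are a generating π-system; entry metric `suEntries`) wants agreement on bounded measurable
local observables with finite COORDINATEWISE Lipschitz constants; such an observable IS a Lipschitz
cylinder function (telescoping over the dependence set, `DobrushinMetric.abs_sub_le_sum_of_dependsOn`,
then McShane extension from the entry image, Mathlib `LipschitzOnWith.extend_real`) —
`exists_isLipschitzCylinder_of_isLipBound`. The smooth shape implies the Lipschitz shape by ds-2's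
mollification lemma `SharpClustering.exists_contDiff_lipschitz_cylinder_approx` (same constant `K`,
uniform error `Kε`): `kernelInfluenceVanishes_of_smooth`. Existence of a DLR state is the tree theorem
`ymGibbsMeasures_nonempty` (compactness).

References: H.-O. Georgii, *Gibbs Measures and Phase Transitions* (2011), Def. 1.23, Remark 1.24,
Thm. 4.17; S. Friedli, Y. Velenik (2017), Lemma 6.22, Lemma 6.30; H. Föllmer, LNM 1362 (1988) Ch. I
Remark (2.17); cell bus 2026-08-22 15:23Z–15:54Z (R132, R132′).
-/

noncomputable section

open scoped Matrix BigOperators Matrix.Norms.Frobenius ContDiff Topology NNReal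
open MeasureTheory Filter Function Finset
open Literature.Probability.LatticeModels
open Literature.Probability.LatticeModels.DobrushinMetric (IsLipBound abs_sub_le_sum_of_dependsOn
  measure_eq_of_forall_integral_eq_of_isLipBound)
open Literature.MathematicalPhysics.QuantumLattice (fundamentalRep continuous_fundamentalRep LGConfig ZdEdge
  ymSpecification ymGibbsMeasures)
open Literature.MathematicalPhysics.QuantumFieldTheory hiding ZdEdge
open Summit.Ventures.YMGap.LatticeBakryEmery (Cfg PSU emb emb_apply LinkLipschitz)

namespace Summit.Ventures.YMGap

namespace SharpUniquenessDLR

/-! ### A general specification lemma: DLR states agree on observables the kernels forget -/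

section General

variable {V S : Type*} [MeasurableSpace S] {γ : Specification V S}

/-- On a probability space, `|∫ f dμ| ≤ C` if `|f| ≤ C` pointwise (no integrability needed: a
non-integrable `f` has integral `0 ≤ C`). -/
theorem abs_integral_le_of_forall_abs_le {Ω : Type*} [MeasurableSpace Ω] {μ : Measure Ω} [IsProbabilityMeasure μ]
    {f : Ω → ℝ} {C : ℝ} (hf : ∀ z, |f z| ≤ C) : |∫ z, f z ∂μ| ≤ C := by
  obtain ⟨z₀⟩ := μ.nonempty_of_neZero
  have hC : 0 ≤ C := (abs_nonneg _).trans (hf z₀)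
  refine (abs_integral_le_integral_abs).trans ?_
  by_cases hi : Integrable (fun z => |f z|) μ
  · calc ∫ z, |f z| ∂μ ≤ ∫ _, C ∂μ := integral_mono hi (integrable_const C) hf
      _ = C := by simp
  · rw [integral_undef hi]; exact hC

/-- On a probability space, `|∫ g dμ − c| ≤ ε` if `|g η − c| ≤ ε` pointwise and `g` is integrable. -/
theorem abs_integral_sub_const_le {Ω : Type*} [MeasurableSpace Ω] {μ : Measure Ω} [IsProbabilityMeasure μ]
    {g : Ω → ℝ} (hg : Integrable g μ) {c ε : ℝ} (h : ∀ η, |g η - c| ≤ ε) :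
    |∫ η, g η ∂μ - c| ≤ ε := by
  have : ∫ η, g η ∂μ - c = ∫ η, (g η - c) ∂μ := by
    rw [integral_sub hg (integrable_const c), integral_const, smul_eq_mul, probReal_univ, one_mul]
  rw [this]
  exact abs_integral_le_of_forall_abs_le h

/-- **DLR states give the same mean to an observable whose kernel means forget the boundary
condition.** If `μ, ν` are Gibbs measures of the specification `γ` and `F` is a bounded measurable
observable such that for every `ε > 0` some kernel `γ_Λ` satisfies
`|γ_Λ(F | η) − γ_Λ(F | η')| ≤ ε` for ALL boundary conditions `η, η'`, then `∫ F dμ = ∫ F dν`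
(DLR in integral form: `μ(F) = ∫ γ_Λ(F | ·) dμ`; Georgii 2011 Remark 1.24). -/
theorem integral_eq_of_kernel_sub_le (hγ : IsSpecification γ) {μ ν : Measure (V → S)}
    (hμ : IsGibbsMeasure γ μ) (hν : IsGibbsMeasure γ ν) {F : (V → S) → ℝ} (hFm : Measurable F)
    (hFb : ∃ C, ∀ σ, |F σ| ≤ C)
    (h : ∀ ε : ℝ, 0 < ε → ∃ Λ : Finset V, ∀ η η' : V → S,
      |∫ σ, F σ ∂(γ Λ η) - ∫ σ, F σ ∂(γ Λ η')| ≤ ε) :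
    ∫ σ, F σ ∂μ = ∫ σ, F σ ∂ν := by
  haveI := hμ.isProbabilityMeasure
  haveI := hν.isProbabilityMeasure
  obtain ⟨C, hC⟩ := hFb
  -- integrability of a bounded measurable observable under any probability measure
  have hFi : ∀ (ρ : Measure (V → S)) [IsProbabilityMeasure ρ], Integrable F ρ := fun ρ _ =>
    (integrable_const C).mono' hFm.aestronglyMeasurable (ae_of_all _ fun σ => by
      rw [Real.norm_eq_abs]; exact hC σ)
  refine le_antisymm ?_ ?_ <;> refine le_of_forall_pos_le_add fun ε hε => ?_ <;>
    obtain ⟨Λ, hΛ⟩ := h (ε / 2) (half_pos hε)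
  all_goals
    obtain ⟨η₀⟩ := μ.nonempty_of_neZero
    set g : (V → S) → ℝ := fun η => ∫ σ, F σ ∂(γ Λ η) with hg
    -- `g` is measurable (kernel measurability) and bounded by `C`
    have hgm : Measurable g := by
      let κ : ProbabilityTheory.Kernel (V → S) (V → S) := ⟨γ Λ, hγ.measurable_fun Λ⟩
      exact (hFm.stronglyMeasurable.integral_kernel (κ := κ)).measurable
    have hgb : ∀ η, |g η| ≤ C := fun η => by
      haveI := hγ.isProbability Λ η
      exact abs_integral_le_of_forall_abs_le hC
    have hgi : ∀ (ρ : Measure (V → S)) [IsProbabilityMeasure ρ], Integrable g ρ := fun ρ _ =>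
      (integrable_const C).mono' hgm.aestronglyMeasurable (ae_of_all _ fun η => by
        rw [Real.norm_eq_abs]; exact hgb η)
    have hμg : ∫ σ, F σ ∂μ = ∫ η, g η ∂μ := (hμ.integral_integral_eq hγ Λ (hFi μ)).symm
    have hνg : ∫ σ, F σ ∂ν = ∫ η, g η ∂ν := (hν.integral_integral_eq hγ Λ (hFi ν)).symm
    have h1 : |∫ η, g η ∂μ - g η₀| ≤ ε / 2 := abs_integral_sub_const_le (hgi μ) fun η => hΛ η η₀
    have h2 : |∫ η, g η ∂ν - g η₀| ≤ ε / 2 := abs_integral_sub_const_le (hgi ν) fun η => hΛ η η₀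
    rw [hμg, hνg]
    rw [abs_le] at h1 h2
  · linarith [h1.1, h1.2, h2.1, h2.2]
  · linarith [h1.1, h1.2, h2.1, h2.2]

end General

/-! ### Coordinatewise-Lipschitz local observables of `SU(N)` gauge fields are Lipschitz cylinder functions -/

section Cylinder

variable {d N : ℕ}

/-- **Telescoping + McShane.** A real observable of `SU(N)` lattice gauge fields depending only on the
links in the finite set `Δ`, with coordinatewise Lipschitz constants `δ_y` for the entry (sup) metric
`dist ∘ suEntries`, is a Lipschitz cylinder function on `Δ` in the tree's sense `IsLipschitzCylinder`
(one globally Lipschitz function of the entry tuple, constant `Σ_{y ∈ Δ} δ_y`): change the links of `Δ`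
one at a time (`DobrushinMetric.abs_sub_le_sum_of_dependsOn`), then extend from the entry image by
McShane's formula (Mathlib `LipschitzOnWith.extend_real`). -/
theorem exists_isLipschitzCylinder_of_isLipBound
    {F : LGConfig d (Matrix.specialUnitaryGroup (Fin N) ℂ) → ℝ} {Δ : Finset (ZdEdge d)} {δ : ZdEdge d → ℝ}
    (hdep : DependsOn F (↑Δ : Set (ZdEdge d)))
    (hδ : IsLipBound (fun a b : Matrix.specialUnitaryGroup (Fin N) ℂ => dist (suEntries a) (suEntries b)) F δ) :
    ∃ K : ℝ≥0, IsLipschitzCylinder (fundamentalRep (Fin N)) F Δ K := by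
  classical
  -- the entry-tuple map and the joint Lipschitz bound along it
  set T : LGConfig d (Matrix.specialUnitaryGroup (Fin N) ℂ) → (↥Δ → Fin N → Fin N → ℂ) :=
    fun U e => suEntries (U e) with hT
  set K : ℝ := ∑ y ∈ Δ, δ y with hK
  have hK0 : 0 ≤ K := Finset.sum_nonneg fun y _ => hδ.nonneg y
  have hjoint : ∀ U U' : LGConfig d (Matrix.specialUnitaryGroup (Fin N) ℂ),
      |F U - F U'| ≤ K * dist (T U) (T U') := by
    intro U U'
    refine (abs_sub_le_sum_of_dependsOn hdep hδ U U').trans ?_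
    rw [hK, Finset.sum_mul]
    refine Finset.sum_le_sum fun y hy => mul_le_mul_of_nonneg_left ?_ (hδ.nonneg y)
    exact dist_le_pi_dist (T U) (T U') ⟨y, hy⟩
  -- a representative of `F` on the entry image, Lipschitz there
  set g₀ : (↥Δ → Fin N → Fin N → ℂ) → ℝ := fun a =>
    if h : ∃ U, T U = a then F h.choose else 0 with hg₀
  have hg₀T : ∀ U, g₀ (T U) = F U := by
    intro U
    have hex : ∃ U', T U' = T U := ⟨U, rfl⟩
    have hunf : g₀ (T U) = if h : (∃ U', T U' = T U) then F h.choose else 0 := rfl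
    rw [hunf, dif_pos hex]
    have h0 : |F hex.choose - F U| ≤ K * dist (T hex.choose) (T U) := hjoint _ _
    rw [hex.choose_spec, dist_self, mul_zero] at h0
    exact eq_of_abs_sub_nonpos h0
  have hLipOn : LipschitzOnWith ⟨K, hK0⟩ g₀ (Set.range T) := by
    refine LipschitzOnWith.of_dist_le_mul fun a ha b hb => ?_
    obtain ⟨U, rfl⟩ := ha
    obtain ⟨U', rfl⟩ := hb
    rw [hg₀T, hg₀T, Real.dist_eq]
    exact hjoint U U'
  obtain ⟨g, hg, hgeq⟩ := hLipOn.extend_real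
  refine ⟨⟨K, hK0⟩, g, hg, fun U => ?_⟩
  have : g (T U) = g₀ (T U) := (hgeq ⟨U, rfl⟩).symm
  rw [← hg₀T U, ← this]
  rfl

end Cylinder

/-! ### The two hypothesis shapes -/

section Shapes

variable (d N : ℕ)

/-- **Binder (B1) — vanishing boundary influence on Lipschitz cylinder functions.** For the `SU(N)` Wilson
specification on `ℤ^d` at tree coupling `β` (`ymSpecification (fundamentalRep (Fin N)) β`): for every
Lipschitz cylinder function `F` (tree `IsLipschitzCylinder`) and every `ε > 0` there is a finite edge set
`E` whose kernel means of `F` differ by at most `ε` between ANY two boundary conditions. A `Prop`; nothing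
is asserted (to be supplied at `|β| < N/(8d)` by pieces U1 + U2 + U3 through the smooth shape below). -/
def KernelInfluenceVanishes (β : ℝ) : Prop :=
  ∀ (F : LGConfig d (Matrix.specialUnitaryGroup (Fin N) ℂ) → ℝ) (Λ : Finset (ZdEdge d)) (K : ℝ≥0),
    IsLipschitzCylinder (fundamentalRep (Fin N)) F Λ K →
    ∀ ε : ℝ, 0 < ε → ∃ E : Finset (ZdEdge d),
      ∀ η η' : LGConfig d (Matrix.specialUnitaryGroup (Fin N) ℂ),
        |∫ U, F U ∂(ymSpecification (d := d) (fundamentalRep (Fin N)) β E η) -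
          ∫ U, F U ∂(ymSpecification (d := d) (fundamentalRep (Fin N)) β E η')| ≤ ε

/-- **Binder (B2) — the smooth shape** (the currency of the cell's Bakry–Émery / covariance files and of
piece U3): the same, for the cylinder observables `matrixCylinder Λ f` with `f` a smooth real function of
the link matrices over `Λ` having per-link Frobenius–Lipschitz data `δ ≥ 0` (`LinkLipschitz f δ`). -/
def SmoothKernelInfluenceVanishes (β : ℝ) : Prop :=
  ∀ (Λ : Finset (ZdEdge d)) (f : Cfg ↥Λ N → ℝ), ContDiff ℝ ∞ f →
    ∀ (δ : ↥Λ → ℝ), (∀ e, 0 ≤ δ e) → LinkLipschitz f δ →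
    ∀ ε : ℝ, 0 < ε → ∃ E : Finset (ZdEdge d),
      ∀ η η' : LGConfig d (Matrix.specialUnitaryGroup (Fin N) ℂ),
        |∫ U, matrixCylinder Λ f U ∂(ymSpecification (d := d) (fundamentalRep (Fin N)) β E η) -
          ∫ U, matrixCylinder Λ f U ∂(ymSpecification (d := d) (fundamentalRep (Fin N)) β E η')| ≤ ε

end Shapes

/-! ### (B1) ⇒ uniqueness of the DLR state -/

section Uniqueness

variable {d N : ℕ}

/-- **THE DLR ASSEMBLY.** If the kernels of the `SU(N)` Wilson specification at tree coupling `β` forget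
their boundary condition on every Lipschitz cylinder function (`KernelInfluenceVanishes d N β`), then the
infinite-volume DLR state is UNIQUE: `HasUniqueGibbsMeasure (ymSpecification (fundamentalRep (Fin N)) β)`
(at most one: two DLR states agree on all Lipschitz cylinder functions by `integral_eq_of_kernel_sub_le`,
hence on all bounded measurable coordinatewise-Lipschitz local observables
(`exists_isLipschitzCylinder_of_isLipBound`), which determine probability measures
(`DobrushinMetric.measure_eq_of_forall_integral_eq_of_isLipBound`); at least one: compactness,
`ymGibbsMeasures_nonempty`). Nothing is asserted about the hypothesis. -/
theorem hasUniqueGibbsMeasure_of_kernelInfluenceVanishes {β : ℝ} (h : KernelInfluenceVanishes d N β) :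
    HasUniqueGibbsMeasure (ymSpecification (d := d) (fundamentalRep (Fin N)) β) := by
  classical
  haveI : SecondCountableTopology (Matrix (Fin N) (Fin N) ℂ) :=
    inferInstanceAs (SecondCountableTopology (Fin N → Fin N → ℂ))
  haveI : SecondCountableTopology (Matrix.specialUnitaryGroup (Fin N) ℂ) :=
    Topology.IsEmbedding.subtypeVal.secondCountableTopology
  have hγ : IsSpecification (ymSpecification (d := d) (fundamentalRep (Fin N)) β) :=
    isSpecification_ymSpecification_of_t2Space _ (continuous_fundamentalRep (Fin N)) _
  refine ⟨?_, ymGibbsMeasures_nonempty (d := d) (fundamentalRep (Fin N)) (continuous_fundamentalRep (Fin N)) β⟩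
  intro μ hμ ν hν
  rw [mem_gibbsMeasures_iff] at hμ hν
  haveI := hμ.isProbabilityMeasure
  haveI := hν.isProbabilityMeasure
  refine measure_eq_of_forall_integral_eq_of_isLipBound suEntries measurableSpace_specialUnitaryGroup_eq_comap
    fun F Δ δ hFm hdep hF1 hδ => ?_
  obtain ⟨K, hK⟩ := exists_isLipschitzCylinder_of_isLipBound hdep hδ
  exact integral_eq_of_kernel_sub_le hγ hμ hν hFm ⟨1, hF1⟩ (h F Δ K hK)

end Uniqueness

/-! ### (B2) ⇒ (B1): smooth cylinders suffice (mollification keeps the Lipschitz constant) -/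

section Smooth

variable {d N : ℕ}

/-- A `K`-Lipschitz function of the entry tuple over `Λ` (sup metric), read as a function of the link
matrices, is `LinkLipschitz` with per-link data `K` (the entry metric is dominated by the Frobenius
distance, `dist_suEntries_le_suFrobDist`). -/
theorem linkLipschitz_of_lipschitzWith (Λ : Finset (ZdEdge d)) {g : (↥Λ → Fin N → Fin N → ℂ) → ℝ}
    {K : ℝ≥0} (hg : LipschitzWith K g) :
    LinkLipschitz (fun Q : Cfg ↥Λ N => g fun e i j => Q e i j) (fun _ => (K : ℝ)) := by
  intro e a b hab
  have hdist : dist (fun (e' : ↥Λ) (i j : Fin N) => emb a e' i j) (fun (e' : ↥Λ) (i j : Fin N) => emb b e' i j) ≤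
      suFrobDist (a e) (b e) := by
    refine (dist_pi_le_iff (suFrobDist_nonneg _ _)).2 fun e' => ?_
    by_cases he : e' = e
    · subst he
      exact dist_suEntries_le_suFrobDist (a e') (b e')
    · have : (fun i j : Fin N => emb a e' i j) = fun i j : Fin N => emb b e' i j := by
        funext i j; rw [emb_apply, emb_apply, hab e' he]
      rw [this, dist_self]
      exact suFrobDist_nonneg _ _
  calc |g (fun (e' : ↥Λ) (i j : Fin N) => emb a e' i j) - g (fun (e' : ↥Λ) (i j : Fin N) => emb b e' i j)|
      ≤ K * dist (fun (e' : ↥Λ) (i j : Fin N) => emb a e' i j) (fun (e' : ↥Λ) (i j : Fin N) => emb b e' i j) := by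
        rw [← Real.dist_eq]; exact hg.dist_le_mul _ _
    _ ≤ K * suFrobDist (a e) (b e) := mul_le_mul_of_nonneg_left hdist K.2

/-- A smooth function of the entry tuple, read as a function of the link matrices, is smooth (the
re-indexing is real-linear). -/
theorem contDiff_readMatrices (Λ : Finset (ZdEdge d)) {g : (↥Λ → Fin N → Fin N → ℂ) → ℝ}
    (hg : ContDiff ℝ ∞ g) : ContDiff ℝ ∞ (fun Q : Cfg ↥Λ N => g fun e i j => Q e i j) := by
  let Tl : Cfg ↥Λ N →ₗ[ℝ] (↥Λ → Fin N → Fin N → ℂ) :=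
    { toFun := fun Q e i j => Q e i j
      map_add' := fun _ _ => rfl
      map_smul' := fun _ _ => rfl }
  have hT : ContDiff ℝ ∞ (fun Q : Cfg ↥Λ N => fun (e : ↥Λ) (i j : Fin N) => Q e i j) :=
    (LinearMap.toContinuousLinearMap Tl).contDiff
  exact hg.comp hT

/-- Kernel means of two uniformly close bounded measurable observables are close. -/
theorem abs_integral_sub_integral_le_of_abs_sub_le {Ω : Type*} [MeasurableSpace Ω] {μ : Measure Ω}
    [IsProbabilityMeasure μ] {F G : Ω → ℝ} (hF : Integrable F μ) (hG : Integrable G μ) {ε : ℝ}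
    (h : ∀ z, |F z - G z| ≤ ε) : |∫ z, F z ∂μ - ∫ z, G z ∂μ| ≤ ε := by
  rw [← integral_sub hF hG]
  exact abs_integral_le_of_forall_abs_le h

/-- **Smooth cylinders suffice**: `SmoothKernelInfluenceVanishes d N β → KernelInfluenceVanishes d N β`.
A Lipschitz cylinder function `F` with constant `K` is uniformly `Kε'`-close to a SMOOTH function of the
entry tuple with the same Lipschitz constant (ds-2's `SharpClustering.exists_contDiff_lipschitz_cylinder_approx`),
which read on the link matrices is a smooth `LinkLipschitz` cylinder with data `K` on every link of `Λ`;
the kernel means of `F` and of its approximant differ by `≤ Kε'` for every boundary condition. -/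
theorem kernelInfluenceVanishes_of_smooth {β : ℝ} (h : SmoothKernelInfluenceVanishes d N β) :
    KernelInfluenceVanishes d N β := by
  classical
  haveI : SecondCountableTopology (Matrix (Fin N) (Fin N) ℂ) :=
    inferInstanceAs (SecondCountableTopology (Fin N → Fin N → ℂ))
  haveI : SecondCountableTopology (Matrix.specialUnitaryGroup (Fin N) ℂ) :=
    Topology.IsEmbedding.subtypeVal.secondCountableTopology
  have hγ : IsSpecification (ymSpecification (d := d) (fundamentalRep (Fin N)) β) :=
    isSpecification_ymSpecification_of_t2Space _ (continuous_fundamentalRep (Fin N)) _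
  intro F Λ K hF ε hε
  -- smooth approximant with the same Lipschitz constant, uniform error `K ε' ≤ ε/4`
  set ε' : ℝ := ε / (4 * ((K : ℝ) + 1)) with hε'
  have hK0 : (0 : ℝ) ≤ K := K.2
  have hε'pos : 0 < ε' := by rw [hε']; positivity
  have hKε' : (K : ℝ) * ε' ≤ ε / 4 := by
    rw [hε', mul_div_assoc', div_le_div_iff₀ (by positivity) (by positivity)]
    nlinarith
  obtain ⟨g, hg, hgK, hgF⟩ := SharpClustering.exists_contDiff_lipschitz_cylinder_approx hF hε'pos
  set f : Cfg ↥Λ N → ℝ := fun Q => g fun e i j => Q e i j with hf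
  have hfs : ContDiff ℝ ∞ f := contDiff_readMatrices Λ hg
  have hfL : LinkLipschitz f (fun _ => (K : ℝ)) := linkLipschitz_of_lipschitzWith Λ hgK
  obtain ⟨E, hE⟩ := h Λ f hfs (fun _ => (K : ℝ)) (fun _ => hK0) hfL (ε / 2) (half_pos hε)
  refine ⟨E, fun η η' => ?_⟩
  -- the approximant read on configurations is `matrixCylinder Λ f`
  have hread : ∀ U : LGConfig d (Matrix.specialUnitaryGroup (Fin N) ℂ),
      matrixCylinder Λ f U = g fun e => suEntries (U e) := fun U => rfl
  have hclose : ∀ U : LGConfig d (Matrix.specialUnitaryGroup (Fin N) ℂ), |F U - matrixCylinder Λ f U| ≤ ε / 4 :=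
    fun U => by rw [hread, abs_sub_comm]; exact (hgF U).trans hKε'
  -- integrability of both observables under the (probability) kernels
  have hFm : Measurable F := hF.measurable
  have hGm : Measurable (matrixCylinder Λ f) := by
    have : matrixCylinder Λ f = g ∘ fun U (e : ↥Λ) => suEntries (U e) := funext hread
    rw [this]
    exact hg.continuous.measurable.comp (measurable_suEntries_tuple Λ)
  have hFb : ∀ U, |F U| ≤ |F 1| + 2 * K := hF.abs_le
  have hGb : ∀ U, |matrixCylinder Λ f U| ≤ |F 1| + 2 * K + ε / 4 := fun U => by
    have h1 := hclose U
    have h2 := hFb U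
    rw [abs_le] at h1 h2 ⊢
    constructor <;> linarith [h1.1, h1.2, h2.1, h2.2]
  have hint : ∀ (ρ : Measure (LGConfig d (Matrix.specialUnitaryGroup (Fin N) ℂ))) [IsProbabilityMeasure ρ]
      {G : LGConfig d (Matrix.specialUnitaryGroup (Fin N) ℂ) → ℝ} (_ : Measurable G) {C : ℝ} (_ : ∀ U, |G U| ≤ C),
      Integrable G ρ := fun ρ _ G hGm' C hC =>
    (integrable_const C).mono' hGm'.aestronglyMeasurable (ae_of_all _ fun U => by
      rw [Real.norm_eq_abs]; exact hC U)
  haveI := hγ.isProbability E η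
  haveI := hγ.isProbability E η'
  have h1 : |∫ U, F U ∂(ymSpecification (d := d) (fundamentalRep (Fin N)) β E η) -
      ∫ U, matrixCylinder Λ f U ∂(ymSpecification (d := d) (fundamentalRep (Fin N)) β E η)| ≤ ε / 4 :=
    abs_integral_sub_integral_le_of_abs_sub_le (hint _ hFm hFb) (hint _ hGm hGb) hclose
  have h2 : |∫ U, F U ∂(ymSpecification (d := d) (fundamentalRep (Fin N)) β E η') -
      ∫ U, matrixCylinder Λ f U ∂(ymSpecification (d := d) (fundamentalRep (Fin N)) β E η')| ≤ ε / 4 :=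
    abs_integral_sub_integral_le_of_abs_sub_le (hint _ hFm hFb) (hint _ hGm hGb) hclose
  have h3 := hE η η'
  rw [abs_le] at h1 h2 h3 ⊢
  constructor <;> linarith [h1.1, h1.2, h2.1, h2.2, h3.1, h3.2]

/-- **THE DLR ASSEMBLY, smooth shape**: `SmoothKernelInfluenceVanishes d N β → HasUniqueGibbsMeasure`. This
is the theorem the JOIN file feeds with U3's boundary-tilt bound at every `|β'| < 1/(8d)` (`β = N β'`). -/
theorem hasUniqueGibbsMeasure_of_smoothKernelInfluenceVanishes {β : ℝ} (h : SmoothKernelInfluenceVanishes d N β) :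
    HasUniqueGibbsMeasure (ymSpecification (d := d) (fundamentalRep (Fin N)) β) :=
  hasUniqueGibbsMeasure_of_kernelInfluenceVanishes (kernelInfluenceVanishes_of_smooth h)

end Smooth

end SharpUniquenessDLR

end Summit.Ventures.YMGap
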